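import Summits.QuantumFields.YangMills.Theorems.BalabanUVNodesN15TwoSpacingGluingNeumannCoverRows
import Summits.QuantumFields.YangMills.Theorems.BalabanUVNodesN15TwoGridAveragingDefect
import Summits.QuantumFields.YangMills.Theorems.BalabanUVNodesN15FullPropagatorEntry2Rows
import HarnessLib

/-!
# THE GLUING STEP AT TWO LATTICE SPACINGS, XXXIV: THE BLOCK-AVERAGING η-DEFECT `𝔇(Q*′Q′, Q*Q)∘(M_{h_k}M_χN)` OF THE REMAINDER ROW — IT LIVES ON DIFFERENTIABLE INPUTS: THE
# η-GRADIENT OF THE CUT PRODUCT FROM THE CUBE's CUT ROWS, dag-n15-a's TWO-GRID CONSISTENCY OF `Q`, `Q*`, AND THE RATE `(L^k)⁻¹` (dag-n15-c g12, FILE 76; N15 = NE2, s1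
# «background-layer OPERATOR ingredient»)

Cell `pub-ymgap`, seat `pub-ymgap-dag-n15-c` (R134 (a); HUMAN RULING D-0062), generation 12.  `bears_on: R4∕N15 · K3⁷ SpineGivenEndpointR13SepCoPH (stmt-QuantumFields-20544)`.
Filed `--supports stmt-QuantumFields-20544 --as helper` — COUNT-NEUTRAL.  Theorems only (0 `def`, 0 `sorry`).  Imports BY NAME FILE 72 (through it FILES 65–67: `chiCube_coverCorner_eq_one_side`,
`chi_eq_one_of_hcube_ne_zero`, `abs_fgrad_coverH_le`, `abs_coverH_le_one`), dag-n15-a parts 43∕44 (`hasMaj_qvRe_pull_sub_comp`, `hasMaj_qvAdjRe_sub_pull_comp`, `hasMaj_qvRe_comp`,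
`hasMaj_qvAdjRe_comp`), part 45 (`symbOp_sD_eq`), FILE 59 (`hasMaj_diag_comp`, `hasMaj_comp_diag`); nothing in the tree is modified.

WHAT.  Torus `M_ν = 2qw`, cube `□_k` of side `S` at the cover's corner (`m₀ + 2w + 1 ≤ S ≤ 2qw`), partition `h_k` at the coarse spacing `n = L^k`, cut `χ = χ_{□_k}`, ANY cube operator `N`
with `N∘M_χ = N` (input cut built in — dag-n15-a `neumannCubeG_eq_chiCube` ∕ `liftOp_comp_mulOp_chiCube`), King's pairing `π`, `P = pull π`, fine spacing `n′ = L^r·L^k`: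
* §1 ★ `fgrad_comp_mulOp_hcube_mulOp` — LEIBNIZ BEHIND THE CUT: `∇_μ∘M_{h_k}∘M_χ∘N = M_{h_k∘e_μ}∘M_χ∘∇_μ∘N + M_{∇_μh_k}∘M_χ∘N` (the cut is constant where `h_k∘e_μ ≠ 0`);
* §2 ★★ `hasMaj_etaGrad_cutProduct` — `η∇_κ(M_{h_k}M_χN) ≤ n⁻¹(β₁ + (π∕w)β)·e^{−δd}` from the cut rows `M_χN ≤ 1_□1_□βe^{−δd}`, `M_χ∇N ≤ 1_□1_□β₁e^{−δd}`;
* §3 ★★★ **`hasMaj_idef_qq_comp_cover`** — `𝔇(Q*′Q′, Q*Q)∘(M_{h_k}M_χN) ≤ 1_□(y′)·r_Q·e^{−ρd}` with `r_Q = e^{2ρ}n⁻¹(β₁ + (π∕w)β) + (2e^{2ρ}∕L^k)β` — the `hQ` socket of FILE 75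
  `hasMaj_idef_nonlocalPart_comp`: `𝔇 = Q*′∘(Q′P − Q) + (Q*′ − PQ*)∘Q` (`idef_comp` through the unit lattice), dag-n15-a's consistencies of `Q` (on the η-gradient, §2) and `Q*`, input
  localization recovered from `N∘M_χ = N`.  RATE `(L^k)⁻¹`, uniform in the volume.

HONEST FRAMING ∕ LIMITS.  Lattice calculus + block-majorant bookkeeping; [B5] (1.18) p.20 block averaging, King's pairing p.664, the two-grid DIFFERENCE TEMPLATE of [B9] Thm 3.14 pp.426–427
at the level of SHAPES; nothing of [B5]∕[B6]∕[B9] asserted.  NE2⁺ NOT PRINTED, NOT proved; N15 NOT discharged; counts of record UNMOVED (typed 28∕28 · discharged 5∕27); one finite 𝕋⁴ at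
fixed ε per index — NOT infinite volume, NOT OS on ℝ⁴, NOT a mass gap, NOT Clay; R4 closes the conditional finite-𝕋⁴ rung `BalabanLadder.UV` only.  Restate-immune.
-/

noncomputable section

namespace Summit.QuantumFields.YangMills.BalabanUVNodes.N15.Gluing

open Real
open Literature.MathematicalPhysics.QuantumFieldTheory.Balaban1983to89
open Literature.MathematicalPhysics.QuantumFieldTheory.Balaban1983to89.B5Prop11Plancherel (Tor fine)
open Literature.MathematicalPhysics.QuantumFieldTheory.Balaban1983to89.B11SectG (BlockNorm HasMaj RowSum hasMaj_comp)
open Literature.MathematicalPhysics.QuantumFieldTheory.Balaban1983to89.T4EtaRateDefect (idef idef_comp)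
open Literature.MathematicalPhysics.QuantumFieldTheory.Balaban1983to89.T4EtaRateCoeffDefect (pull pull_apply diagK diagK_nonneg hasMaj_mulOp)
open Literature.MathematicalPhysics.QuantumFieldTheory.Balaban1983to89.B6Prop26Gluing (mulOp mulOp_apply ind ind_nonneg ind_le_one)
open Literature.MathematicalPhysics.QuantumFieldTheory.Balaban1983to89.B6UnitTorusCarrier (unitTorusGeo)
open Literature.MathematicalPhysics.QuantumFieldTheory.King1986.Torus (blockOf tdistT tdistT_nonneg)
open Summit.QuantumFields.YangMills.BalabanUVNodes.N15.VectorPiece (bshiftEquiv kingPrV blkFine)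
open Summit.QuantumFields.YangMills.BalabanUVNodes.N15.BackgroundLayer (fgrad fgrad_apply symbOp_sD_eq)
open Summit.QuantumFields.YangMills.BalabanUVNodes.N15.TwoGrid (symbOp sD chiCube cubeBlocks qvRe qvAdjRe hasMaj_qvRe_pull_sub_comp hasMaj_qvAdjRe_sub_pull_comp hasMaj_qvRe_comp
  hasMaj_qvAdjRe_comp hasMaj_smul_ofBlocks)

variable {d : ℕ}

/-! ## §1 Leibniz behind the cut -/

section Leibniz

variable {X : Type} {J : Type} [Fintype J] (K : ℕ) (ξ : J → X → ℝ) (e : J → X ≃ X) (μ : J) {k : J → ZMod K} {χ : X → ℝ}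

/-- ★ **LEIBNIZ BEHIND THE CUT**: if `χ = 1` within one step of `supp h_k`, then `∇_μ∘M_{h_k}∘M_χ∘N = M_{h_k∘e_μ}∘M_χ∘∇_μ∘N + M_{∇_μh_k}∘M_χ∘N`. [cite: Balaban1984PropagatorsI, (1.2)–(1.3) p.18 (lattice Leibniz: shape)] -/
theorem fgrad_comp_mulOp_hcube_mulOp (n : ℝ)
    (hχ : ∀ x : X, (∃ x₀ : X, (x₀ = x ∨ x₀ = e μ x ∨ x₀ = (e μ).symm x) ∧ ∀ ν, |cenRep K (ξ ν x₀ - ((k ν).val : ℝ))| < 1) → χ x = 1)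
    (N : (X → ℝ) →ₗ[ℝ] (X → ℝ)) :
    fgrad n (e μ) ∘ₗ (mulOp (hcube K ξ k) ∘ₗ (mulOp χ ∘ₗ N)) =
      mulOp (hcube K ξ k ∘ (e μ)) ∘ₗ (mulOp χ ∘ₗ (fgrad n (e μ) ∘ₗ N)) + mulOp (fgrad n (e μ) (hcube K ξ k)) ∘ₗ (mulOp χ ∘ₗ N) := by
  refine LinearMap.ext fun f => funext fun x => ?_
  simp only [LinearMap.comp_apply, LinearMap.add_apply, Pi.add_apply, fgrad_apply, mulOp_apply, Function.comp_apply]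
  by_cases h1 : hcube K ξ k (e μ x) = 0
  · rw [h1]; ring
  · have hx1 : χ (e μ x) = 1 := chi_eq_one_of_hcube_ne_zero K ξ e μ hχ (Or.inl rfl) h1
    have hx0 : χ x = 1 := chi_eq_one_of_hcube_ne_zero K ξ e μ hχ (Or.inr (Or.inl rfl)) h1
    rw [hx1, hx0]; ring

end Leibniz

/-! ## §2 The η-gradient of the cut product -/

section Grad

variable {M : Fin (d + 1) → ℕ} [∀ μ, NeZero (M μ)] {L kk w q m₀ S : ℕ} [NeZero L]

/-- ★★ **`η∇_κ(M_{h_k}∘M_χ∘N) ≤ n⁻¹(β₁ + (π∕w)β)·e^{−δd}`** (`n = L^k`, `η∇_κ = n⁻¹ρ(sD_κ n)`): Leibniz behind the cut (§1 on FILE 72's window), `|h_k∘e| ≤ 1`, `|∇h_k| ≤ π∕w` (FILE 67), the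
cut rows `M_χ∇_κN ≤ 1_□1_□β₁e^{−δd}`, `M_χN ≤ 1_□1_□βe^{−δd}`. [cite: Balaban1984PropagatorsII, (2.133)–(2.134) p.247 (entries: shapes)] -/
theorem hasMaj_etaGrad_cutProduct (hM : ∀ ν, M ν = 2 * q * w) (hw : 0 < w) (hfit : m₀ + 2 * w + 1 ≤ S) (hS : S ≤ 2 * q * w) (k : Fin (d + 1) → ZMod (2 * q))
    {N : (Tor (fine (L ^ kk) M) × Fin (d + 1) → ℝ) →ₗ[ℝ] (Tor (fine (L ^ kk) M) × Fin (d + 1) → ℝ)} {β β₁ δ : ℝ} (hβ : 0 ≤ β) (hβ₁ : 0 ≤ β₁)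
    (hGc : HasMaj (BlockNorm.ofBlocks (unitTorusGeo L kk M) (fun b : Tor (fine (L ^ kk) M) × Fin (d + 1) => blockOf (L ^ kk) M b.1))
      (BlockNorm.ofBlocks (unitTorusGeo L kk M) (fun b : Tor (fine (L ^ kk) M) × Fin (d + 1) => blockOf (L ^ kk) M b.1))
      (mulOp (chiCube M (L ^ kk) (coverCorner M w q m₀ k) S) ∘ₗ N)
      (fun y y' => ind ((cubeBlocks M (coverCorner M w q m₀ k) S : Finset (Tor M)) : Set (Tor M)) y * ind ((cubeBlocks M (coverCorner M w q m₀ k) S : Finset (Tor M)) : Set (Tor M)) y' *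
        (β * Real.exp (-(δ * tdistT M y y')))))
    (hDc : ∀ μ, HasMaj (BlockNorm.ofBlocks (unitTorusGeo L kk M) (fun b : Tor (fine (L ^ kk) M) × Fin (d + 1) => blockOf (L ^ kk) M b.1))
      (BlockNorm.ofBlocks (unitTorusGeo L kk M) (fun b : Tor (fine (L ^ kk) M) × Fin (d + 1) => blockOf (L ^ kk) M b.1))
      (mulOp (chiCube M (L ^ kk) (coverCorner M w q m₀ k) S) ∘ₗ (fgrad ((L ^ kk : ℕ) : ℝ) (bshiftEquiv M (L ^ kk) μ) ∘ₗ N))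
      (fun y y' => ind ((cubeBlocks M (coverCorner M w q m₀ k) S : Finset (Tor M)) : Set (Tor M)) y * ind ((cubeBlocks M (coverCorner M w q m₀ k) S : Finset (Tor M)) : Set (Tor M)) y' *
        (β₁ * Real.exp (-(δ * tdistT M y y'))))) (κ : Fin (d + 1)) :
    HasMaj (BlockNorm.ofBlocks (unitTorusGeo L kk M) (fun b : Tor (fine (L ^ kk) M) × Fin (d + 1) => blockOf (L ^ kk) M b.1))
      (BlockNorm.ofBlocks (unitTorusGeo L kk M) (blkFine L kk M))
      (((((L ^ kk : ℕ) : ℝ))⁻¹ • symbOp M (L ^ kk) (sD M (L ^ kk) κ ((L ^ kk : ℕ) : ℝ))) ∘ₗ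
        (mulOp (hcube (2 * q) (coverXi M (L ^ kk) w) k) ∘ₗ (mulOp (chiCube M (L ^ kk) (coverCorner M w q m₀ k) S) ∘ₗ N)))
      (fun y y' => (((L ^ kk : ℕ) : ℝ))⁻¹ * (1 * β₁ + π / w * β) * Real.exp (-(δ * tdistT M y y'))) := by
  have hχ := chiCube_coverCorner_eq_one_side (M := M) (n := L ^ kk) (m₀ := m₀) hM hw hfit hS κ k
  have hleib := fgrad_comp_mulOp_hcube_mulOp (2 * q) (coverXi M (L ^ kk) w) (bshiftEquiv M (L ^ kk)) κ ((L ^ kk : ℕ) : ℝ) hχ N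
  -- the two terms
  have hM1 := hasMaj_mulOp (g := unitTorusGeo L kk M) (fun b : Tor (fine (L ^ kk) M) × Fin (d + 1) => blockOf (L ^ kk) M b.1)
    (a := hcube (2 * q) (coverXi M (L ^ kk) w) k ∘ (bshiftEquiv M (L ^ kk) κ)) (m := fun _ => (1 : ℝ)) (fun _ => zero_le_one) fun x => abs_coverH_le_one k _
  have hM2 := hasMaj_mulOp (g := unitTorusGeo L kk M) (fun b : Tor (fine (L ^ kk) M) × Fin (d + 1) => blockOf (L ^ kk) M b.1)
    (a := fgrad ((L ^ kk : ℕ) : ℝ) (bshiftEquiv M (L ^ kk) κ) (hcube (2 * q) (coverXi M (L ^ kk) w) k)) (m := fun _ => π / w) (fun _ => by positivity)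
    fun x => abs_fgrad_coverH_le hM hw k κ x
  have t1 := hasMaj_diag_comp (g := unitTorusGeo L kk M) (fun b : Tor (fine (L ^ kk) M) × Fin (d + 1) => blockOf (L ^ kk) M b.1) (fun _ => zero_le_one) hM1 (hDc κ)
  have t2 := hasMaj_diag_comp (g := unitTorusGeo L kk M) (fun b : Tor (fine (L ^ kk) M) × Fin (d + 1) => blockOf (L ^ kk) M b.1) (fun _ => by positivity) hM2 hGc
  have hsum : HasMaj (BlockNorm.ofBlocks (unitTorusGeo L kk M) (fun b : Tor (fine (L ^ kk) M) × Fin (d + 1) => blockOf (L ^ kk) M b.1))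
      (BlockNorm.ofBlocks (unitTorusGeo L kk M) (fun b : Tor (fine (L ^ kk) M) × Fin (d + 1) => blockOf (L ^ kk) M b.1))
      (fgrad ((L ^ kk : ℕ) : ℝ) (bshiftEquiv M (L ^ kk) κ) ∘ₗ (mulOp (hcube (2 * q) (coverXi M (L ^ kk) w) k) ∘ₗ (mulOp (chiCube M (L ^ kk) (coverCorner M w q m₀ k) S) ∘ₗ N)))
      (fun y y' => (1 * β₁ + π / w * β) * Real.exp (-(δ * tdistT M y y'))) := by
    rw [hleib]
    refine (t1.add t2).mono fun y y' => ?_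
    have hi : ind ((cubeBlocks M (coverCorner M w q m₀ k) S : Finset (Tor M)) : Set (Tor M)) y * ind ((cubeBlocks M (coverCorner M w q m₀ k) S : Finset (Tor M)) : Set (Tor M)) y' ≤ 1 := by
      calc ind ((cubeBlocks M (coverCorner M w q m₀ k) S : Finset (Tor M)) : Set (Tor M)) y * ind ((cubeBlocks M (coverCorner M w q m₀ k) S : Finset (Tor M)) : Set (Tor M)) y'
          ≤ 1 * 1 := mul_le_mul (ind_le_one _ _) (ind_le_one _ _) (ind_nonneg _ _) zero_le_one
        _ = 1 := one_mul 1
    have hi0 : 0 ≤ ind ((cubeBlocks M (coverCorner M w q m₀ k) S : Finset (Tor M)) : Set (Tor M)) y * ind ((cubeBlocks M (coverCorner M w q m₀ k) S : Finset (Tor M)) : Set (Tor M)) y' :=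
      mul_nonneg (ind_nonneg _ _) (ind_nonneg _ _)
    have hE := Real.exp_nonneg (-(δ * tdistT M y y'))
    have hw' : (0 : ℝ) ≤ π / w := by positivity
    have hA : 0 ≤ (1 * β₁ + π / w * β) * Real.exp (-(δ * tdistT M y y')) := by positivity
    calc (1 : ℝ) * (ind ((cubeBlocks M (coverCorner M w q m₀ k) S : Finset (Tor M)) : Set (Tor M)) y * ind ((cubeBlocks M (coverCorner M w q m₀ k) S : Finset (Tor M)) : Set (Tor M)) y' *
          (β₁ * Real.exp (-(δ * tdistT M y y')))) +
          π / w * (ind ((cubeBlocks M (coverCorner M w q m₀ k) S : Finset (Tor M)) : Set (Tor M)) y * ind ((cubeBlocks M (coverCorner M w q m₀ k) S : Finset (Tor M)) : Set (Tor M)) y' *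
          (β * Real.exp (-(δ * tdistT M y y'))))
        = (ind ((cubeBlocks M (coverCorner M w q m₀ k) S : Finset (Tor M)) : Set (Tor M)) y * ind ((cubeBlocks M (coverCorner M w q m₀ k) S : Finset (Tor M)) : Set (Tor M)) y') *
          ((1 * β₁ + π / w * β) * Real.exp (-(δ * tdistT M y y'))) := by ring
      _ ≤ 1 * ((1 * β₁ + π / w * β) * Real.exp (-(δ * tdistT M y y'))) := mul_le_mul_of_nonneg_right hi hA
      _ = _ := by ring
  have hsc := hasMaj_smul_ofBlocks (g := unitTorusGeo L kk M) (fun b : Tor (fine (L ^ kk) M) × Fin (d + 1) => blockOf (L ^ kk) M b.1) (fun y y' => by positivity)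
    ((((L ^ kk : ℕ) : ℝ))⁻¹) hsum
  rw [← symbOp_sD_eq, ← LinearMap.smul_comp] at hsc
  refine hsc.mono fun y y' => le_of_eq ?_
  rw [abs_of_nonneg (by positivity)]
  ring

end Grad

/-! ## §3 The block-averaging defect composite -/

section QQ

variable {M : Fin (d + 1) → ℕ} [∀ μ, NeZero (M μ)] {L kk r w q m₀ S : ℕ} [NeZero L]

omit [NeZero L] in
/-- `|χ_□(x)| ≤ 1_□(B(x))`: the cut is dominated by the indicator of the cube's blocks. [folklore] -/
theorem abs_chiCube_le_ind (n : ℕ) [NeZero n] (c : Tor M) (S : ℕ) (x : Tor (fine n M) × Fin (d + 1)) :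
    |chiCube M n c S x| ≤ ind (g := unitTorusGeo L kk M) ((cubeBlocks M c S : Finset (Tor M)) : Set (Tor M)) (blockOf n M x.1) := by
  unfold chiCube
  by_cases hx : blockOf n M x.1 ∈ cubeBlocks M c S
  · rw [if_pos hx, abs_one]
    simp [ind, hx]
  · rw [if_neg hx, abs_zero]; exact ind_nonneg _ _

/-- ★★★ **THE BLOCK-AVERAGING η-DEFECT COMPOSITE** (FILE 75's `hQ`): for a cube operator with `N∘M_χ = N` and cut rows `β`, `β₁` (coarse), `0 ≤ ρ ≤ δ`:
`𝔇(Q*′Q′, Q*Q)∘(M_{h_k}∘(M_χ∘N)) ≤ 1_□(y′)·(e^{2ρ}·n⁻¹(β₁ + (π∕w)β) + (2e^{2ρ}∕L^k)·β)·e^{−ρ|y−y′|_T}` — `𝔇 = Q*′∘(Q′P − Q) + (Q*′ − PQ*)∘Q` through the unit lattice, dag-n15-a's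
two-grid consistencies of `Q` (fed by §2) and of `Q*` (fed by `Q∘M_hM_χN`), the input localization from `N = N∘M_χ`.  RATE `(L^k)⁻¹`.
[cite: Balaban1984PropagatorsI, (1.18) p.20 (block averaging); King1986, p.664 (pairing), Prop. 3.9 p.664 (η-rate shape); Balaban1985BackgroundPropagators, Thm 3.14 pp.426–427 (template)] -/
theorem hasMaj_idef_qq_comp_cover (hM : ∀ ν, M ν = 2 * q * w) (hw : 0 < w) (hfit : m₀ + 2 * w + 1 ≤ S) (hS : S ≤ 2 * q * w) (k : Fin (d + 1) → ZMod (2 * q))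
    {N : (Tor (fine (L ^ kk) M) × Fin (d + 1) → ℝ) →ₗ[ℝ] (Tor (fine (L ^ kk) M) × Fin (d + 1) → ℝ)} {β β₁ δ ρ : ℝ} (hβ : 0 ≤ β) (hβ₁ : 0 ≤ β₁) (hρ : 0 ≤ ρ) (hρδ : ρ ≤ δ)
    (hNχ : N ∘ₗ mulOp (chiCube M (L ^ kk) (coverCorner M w q m₀ k) S) = N)
    (hGc : HasMaj (BlockNorm.ofBlocks (unitTorusGeo L kk M) (fun b : Tor (fine (L ^ kk) M) × Fin (d + 1) => blockOf (L ^ kk) M b.1))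
      (BlockNorm.ofBlocks (unitTorusGeo L kk M) (fun b : Tor (fine (L ^ kk) M) × Fin (d + 1) => blockOf (L ^ kk) M b.1))
      (mulOp (chiCube M (L ^ kk) (coverCorner M w q m₀ k) S) ∘ₗ N)
      (fun y y' => ind ((cubeBlocks M (coverCorner M w q m₀ k) S : Finset (Tor M)) : Set (Tor M)) y * ind ((cubeBlocks M (coverCorner M w q m₀ k) S : Finset (Tor M)) : Set (Tor M)) y' *
        (β * Real.exp (-(δ * tdistT M y y')))))
    (hDc : ∀ μ, HasMaj (BlockNorm.ofBlocks (unitTorusGeo L kk M) (fun b : Tor (fine (L ^ kk) M) × Fin (d + 1) => blockOf (L ^ kk) M b.1))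
      (BlockNorm.ofBlocks (unitTorusGeo L kk M) (fun b : Tor (fine (L ^ kk) M) × Fin (d + 1) => blockOf (L ^ kk) M b.1))
      (mulOp (chiCube M (L ^ kk) (coverCorner M w q m₀ k) S) ∘ₗ (fgrad ((L ^ kk : ℕ) : ℝ) (bshiftEquiv M (L ^ kk) μ) ∘ₗ N))
      (fun y y' => ind ((cubeBlocks M (coverCorner M w q m₀ k) S : Finset (Tor M)) : Set (Tor M)) y * ind ((cubeBlocks M (coverCorner M w q m₀ k) S : Finset (Tor M)) : Set (Tor M)) y' *
        (β₁ * Real.exp (-(δ * tdistT M y y'))))) :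
    HasMaj (BlockNorm.ofBlocks (unitTorusGeo L kk M) (fun b : Tor (fine (L ^ kk) M) × Fin (d + 1) => blockOf (L ^ kk) M b.1))
      (BlockNorm.ofBlocks (unitTorusGeo L kk M) (fun i : Tor (fine (L ^ r * L ^ kk) M) × Fin (d + 1) => blockOf (L ^ r * L ^ kk) M i.1))
      (idef (pull (kingPrV L kk r M)) (pull (kingPrV L kk r M)) (qvAdjRe M (L ^ r * L ^ kk) ∘ₗ qvRe M (L ^ r * L ^ kk)) (qvAdjRe M (L ^ kk) ∘ₗ qvRe M (L ^ kk)) ∘ₗ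
        (mulOp (hcube (2 * q) (coverXi M (L ^ kk) w) k) ∘ₗ (mulOp (chiCube M (L ^ kk) (coverCorner M w q m₀ k) S) ∘ₗ N)))
      (fun y y' => ind ((cubeBlocks M (coverCorner M w q m₀ k) S : Finset (Tor M)) : Set (Tor M)) y' *
        ((Real.exp ρ * Real.exp ρ * ((((L ^ kk : ℕ) : ℝ))⁻¹ * (1 * β₁ + π / w * β)) + 2 * Real.exp ρ / (L : ℝ) ^ kk * (β * Real.exp ρ)) * Real.exp (-(ρ * tdistT M y y')))) := by
  set X := mulOp (hcube (2 * q) (coverXi M (L ^ kk) w) k) ∘ₗ (mulOp (chiCube M (L ^ kk) (coverCorner M w q m₀ k) S) ∘ₗ N) with hXdef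
  have hn0 : (0 : ℝ) ≤ (((L ^ kk : ℕ) : ℝ))⁻¹ := by positivity
  -- rows at rate `ρ`: the η-gradient of `X` (§2) and `X` itself, unlocalized
  have hind : ∀ y y' : Tor M, 0 ≤ ind (g := unitTorusGeo L kk M) ((cubeBlocks M (coverCorner M w q m₀ k) S : Finset (Tor M)) : Set (Tor M)) y *
      ind (g := unitTorusGeo L kk M) ((cubeBlocks M (coverCorner M w q m₀ k) S : Finset (Tor M)) : Set (Tor M)) y' := fun y y' => mul_nonneg (ind_nonneg _ _) (ind_nonneg _ _)
  have hrate : ∀ y y' : Tor M, Real.exp (-(δ * tdistT M y y')) ≤ Real.exp (-(ρ * tdistT M y y')) := fun y y' => Real.exp_le_exp.mpr (by nlinarith [tdistT_nonneg M y y'])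
  have hgrad : ∀ κ, HasMaj (BlockNorm.ofBlocks (unitTorusGeo L kk M) (fun b : Tor (fine (L ^ kk) M) × Fin (d + 1) => blockOf (L ^ kk) M b.1))
      (BlockNorm.ofBlocks (unitTorusGeo L kk M) (blkFine L kk M)) (((((L ^ kk : ℕ) : ℝ))⁻¹ • symbOp M (L ^ kk) (sD M (L ^ kk) κ ((L ^ kk : ℕ) : ℝ))) ∘ₗ X)
      (fun y y' => (((L ^ kk : ℕ) : ℝ))⁻¹ * (1 * β₁ + π / w * β) * Real.exp (-(ρ * tdistT M y y'))) := fun κ =>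
    (hasMaj_etaGrad_cutProduct (L := L) (kk := kk) hM hw hfit hS k hβ hβ₁ hGc hDc κ).mono fun y y' => mul_le_mul_of_nonneg_left (hrate y y') (by positivity)
  have hMh := hasMaj_mulOp (g := unitTorusGeo L kk M) (fun b : Tor (fine (L ^ kk) M) × Fin (d + 1) => blockOf (L ^ kk) M b.1)
    (a := hcube (2 * q) (coverXi M (L ^ kk) w) k) (m := fun _ => (1 : ℝ)) (fun _ => zero_le_one) fun x => abs_coverH_le_one k x
  have hX : HasMaj (BlockNorm.ofBlocks (unitTorusGeo L kk M) (fun b : Tor (fine (L ^ kk) M) × Fin (d + 1) => blockOf (L ^ kk) M b.1))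
      (BlockNorm.ofBlocks (unitTorusGeo L kk M) (fun b : Tor (fine (L ^ kk) M) × Fin (d + 1) => blockOf (L ^ kk) M b.1)) X (fun y y' => β * Real.exp (-(ρ * tdistT M y y'))) := by
    refine (hasMaj_diag_comp (g := unitTorusGeo L kk M) (fun b : Tor (fine (L ^ kk) M) × Fin (d + 1) => blockOf (L ^ kk) M b.1) (fun _ => zero_le_one) hMh hGc).mono fun y y' => ?_
    have hi : ind (g := unitTorusGeo L kk M) ((cubeBlocks M (coverCorner M w q m₀ k) S : Finset (Tor M)) : Set (Tor M)) y *
        ind (g := unitTorusGeo L kk M) ((cubeBlocks M (coverCorner M w q m₀ k) S : Finset (Tor M)) : Set (Tor M)) y' ≤ 1 := by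
      calc _ ≤ (1 : ℝ) * 1 := mul_le_mul (ind_le_one _ _) (ind_le_one _ _) (ind_nonneg _ _) zero_le_one
        _ = 1 := one_mul 1
    have hE := Real.exp_nonneg (-(ρ * tdistT M y y'))
    have := hrate y y'
    nlinarith [mul_nonneg hβ hE, hind y y', mul_nonneg hβ (Real.exp_nonneg (-(δ * tdistT M y y')))]
  -- `Q′P − Q` on `X`, then `Q*′`
  have hQ1 := hasMaj_qvRe_pull_sub_comp M kk r (b₁ := BlockNorm.ofBlocks (unitTorusGeo L kk M) (fun b : Tor (fine (L ^ kk) M) × Fin (d + 1) => blockOf (L ^ kk) M b.1))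
    (S := X) (by positivity) hρ hgrad
  have hT1 := hasMaj_qvAdjRe_comp M kk (L ^ r * L ^ kk) (by positivity) hρ hQ1
  -- `Q` on `X`, then `Q*′ − PQ*`
  have hQ2 := hasMaj_qvRe_comp M kk (L ^ kk) hβ hρ hX
  have hT2 := hasMaj_qvAdjRe_sub_pull_comp M kk r (b₁ := BlockNorm.ofBlocks (unitTorusGeo L kk M) (fun b : Tor (fine (L ^ kk) M) × Fin (d + 1) => blockOf (L ^ kk) M b.1))
    (S := qvRe M (L ^ kk) ∘ₗ X) (by positivity) hρ hQ2
  -- the algebra through the unit lattice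
  have hop : idef (pull (kingPrV L kk r M)) (pull (kingPrV L kk r M)) (qvAdjRe M (L ^ r * L ^ kk) ∘ₗ qvRe M (L ^ r * L ^ kk)) (qvAdjRe M (L ^ kk) ∘ₗ qvRe M (L ^ kk)) ∘ₗ X =
      qvAdjRe M (L ^ r * L ^ kk) ∘ₗ ((qvRe M (L ^ r * L ^ kk) ∘ₗ pull (kingPrV L kk r M) - qvRe M (L ^ kk)) ∘ₗ X) +
        (qvAdjRe M (L ^ r * L ^ kk) - pull (kingPrV L kk r M) ∘ₗ qvAdjRe M (L ^ kk)) ∘ₗ (qvRe M (L ^ kk) ∘ₗ X) := by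
    rw [idef_comp (pull (kingPrV L kk r M)) LinearMap.id (pull (kingPrV L kk r M)), LinearMap.add_comp, LinearMap.comp_assoc, LinearMap.comp_assoc]
    simp only [idef, LinearMap.id_comp, LinearMap.comp_id]
  have hsum := hT1.add hT2
  rw [← hop] at hsum
  -- input localization from `N = N∘M_χ`
  have hXχ : idef (pull (kingPrV L kk r M)) (pull (kingPrV L kk r M)) (qvAdjRe M (L ^ r * L ^ kk) ∘ₗ qvRe M (L ^ r * L ^ kk)) (qvAdjRe M (L ^ kk) ∘ₗ qvRe M (L ^ kk)) ∘ₗ X =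
      (idef (pull (kingPrV L kk r M)) (pull (kingPrV L kk r M)) (qvAdjRe M (L ^ r * L ^ kk) ∘ₗ qvRe M (L ^ r * L ^ kk)) (qvAdjRe M (L ^ kk) ∘ₗ qvRe M (L ^ kk)) ∘ₗ X) ∘ₗ
        mulOp (chiCube M (L ^ kk) (coverCorner M w q m₀ k) S) := by
    rw [LinearMap.comp_assoc, hXdef, LinearMap.comp_assoc, LinearMap.comp_assoc, hNχ]
  have hχ := hasMaj_mulOp (g := unitTorusGeo L kk M) (fun b : Tor (fine (L ^ kk) M) × Fin (d + 1) => blockOf (L ^ kk) M b.1)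
    (a := chiCube M (L ^ kk) (coverCorner M w q m₀ k) S) (m := fun y => ind (g := unitTorusGeo L kk M) ((cubeBlocks M (coverCorner M w q m₀ k) S : Finset (Tor M)) : Set (Tor M)) y)
    (fun y => ind_nonneg _ _) fun x => abs_chiCube_le_ind (L := L) (kk := kk) (L ^ kk) _ S x
  rw [hXχ]
  refine (hasMaj_comp_diag (g := unitTorusGeo L kk M) (fun b : Tor (fine (L ^ kk) M) × Fin (d + 1) => blockOf (L ^ kk) M b.1) (fun y y' => ?_) hsum hχ).mono fun y y' => le_of_eq (by ring)
  positivity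

end QQ

end Summit.QuantumFields.YangMills.BalabanUVNodes.N15.Gluing

end
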